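import Mathlib
import Summits.MatrixMultiplication.MatrixMultiplication.Theses.PauliSmithLocalisation
import Literature.Computability.AlgebraicComplexity.SupportRank
import Literature.Computability.AlgebraicComplexity.PartialMatrixMultiplicationProofs

/-!
# Route PauliSmithLocalisation — transfers from the crux cards' open leaves to `SmithPhaseGap`

The two round-1 crux cards on `FixedPointFreeTargets` (stmt-MatrixMultiplication-15042) each
propose a STRONGER open leaf that transfers to the route's coordinate target `SmithPhaseGap`
(item stmt-MatrixMultiplication-9876), and from there to the crux by the tautological target
(`Theorems.PauliTautologicalTarget.FixedPointFreeTargets_of`).  The leaves are conjectural, so they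
are not declared here; this file proves the two transfers with the leaf as an explicit hypothesis,
stated verbatim as on the cards:

* `smithPhaseGap_of_supportGap` — C⁺ of card `support-exponent-descent` (border SUPPORT rank gap:
  every tensor with the support of `⟨p^k,p^k,p^k⟩` has border rank `> (p^k)^(2+δ)` eventually)
  ⇒ `SmithPhaseGap` (take `t = ⟨p^k,p^k,p^k⟩`, `SameSupport.refl`).
* `smithPhaseGap_of_kroneckerGap` — C⁺⁺ of card `one-step-kronecker-gap` (uniform one-step gain
  `bR ⟨p^(k+1)⟩ ≥ p²(1+ε) · bR ⟨p^k⟩` for all large `k`) ⇒ `SmithPhaseGap`: geometric growth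
  from `bR ⟨p^k₀⟩ ≥ 1` beats `(p^k)^(2+δ)` for `p^δ = (1+ε)^(1/2)`.

References: H. Cohn, C. Umans, *Fast matrix multiplication using coherent configurations*, SODA
2013, §3 (support rank); A. Conner, F. Gesmundo, J. M. Landsberg, E. Ventura, *Rank and border rank
of Kronecker powers of tensors and Strassen's laser method*, comput. complexity 31 (2022), §1;
M. Bläser, *Fast Matrix Multiplication*, Theory of Computing Graduate Surveys 5 (2013), §6.
-/

set_option linter.dupNamespace false

noncomputable section

namespace Summit.MatrixMultiplication.MatrixMultiplication.Theorems

open Filter Literature.Computability.AlgebraicComplexity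

/-- **Transfer C⁺ ⇒ SmithPhaseGap** (card `support-exponent-descent`): a border-support-rank gap
for `⟨p^k,p^k,p^k⟩` gives the border-rank gap, by specialising to `t = ⟨p^k,p^k,p^k⟩` itself
(`SameSupport.refl`). [cite: CohnUmans2013, §3] -/
theorem smithPhaseGap_of_supportGap
    (h : ∃ p : ℕ, p.Prime ∧ ∃ δ : ℝ, 0 < δ ∧ ∃ k₀ : ℕ, ∀ k : ℕ, k₀ ≤ k →
      ∀ t : Fin (p ^ k) × Fin (p ^ k) → Fin (p ^ k) × Fin (p ^ k) → Fin (p ^ k) × Fin (p ^ k) → ℂ,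
        SameSupport t (matMulTensor ℂ (p ^ k) (p ^ k) (p ^ k)) →
          ((p ^ k : ℕ) : ℝ) ^ (2 + δ) < (algBorderRank t : ℝ)) :
    Theses.PauliSmithLocalisation.SmithPhaseGap := by
  obtain ⟨p, hp, δ, hδ, k₀, hk⟩ := h
  exact ⟨p, hp, δ, hδ, k₀, fun k hk₀ => hk k hk₀ _ (SameSupport.refl _)⟩

/-- `⟨n,n,n⟩ ≠ 0` for `n ≥ 1`, hence `bR ⟨n,n,n⟩ ≥ 1`. [cite: Blaser2013, §6] -/
theorem one_le_algBorderRank_matMulTensor {n : ℕ} (hn : 1 ≤ n) :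
    1 ≤ algBorderRank (matMulTensor ℂ n n n) := by
  refine one_le_algBorderRank_of_ne_zero fun h0 => ?_
  have h1 := congrFun (congrFun (congrFun h0 (⟨0, hn⟩, ⟨0, hn⟩)) (⟨0, hn⟩, ⟨0, hn⟩)) (⟨0, hn⟩, ⟨0, hn⟩)
  simp [matMulTensor] at h1

/-- **Transfer C⁺⁺ ⇒ SmithPhaseGap** (card `one-step-kronecker-gap`): a uniform gain
`bR ⟨p^(k+1)⟩ ≥ p²(1+ε) · bR ⟨p^k⟩` from `k₀` on gives `bR ⟨p^(k₀+j)⟩ ≥ (p²(1+ε))^j`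
(`bR ⟨p^k₀⟩ ≥ 1`), which beats `(p^(k₀+j))^(2+δ) = p^(2(k₀+j)) (1+ε)^((k₀+j)/2)` for
`p^δ = (1+ε)^(1/2)` as soon as `(1+ε)^((k₀+j)/2) > (p²(1+ε))^k₀`.
[cite: ConnerGesmundoLandsbergVentura2022, §1] -/
theorem smithPhaseGap_of_kroneckerGap
    (h : ∃ p : ℕ, p.Prime ∧ ∃ ε : ℝ, 0 < ε ∧ ∃ k₀ : ℕ, ∀ k : ℕ, k₀ ≤ k →
      (p : ℝ) ^ 2 * (1 + ε) * (algBorderRank (matMulTensor ℂ (p ^ k) (p ^ k) (p ^ k)) : ℝ) ≤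
        (algBorderRank (matMulTensor ℂ (p ^ (k + 1)) (p ^ (k + 1)) (p ^ (k + 1))) : ℝ)) :
    Theses.PauliSmithLocalisation.SmithPhaseGap := by
  obtain ⟨p, hp, ε, hε, k₀, hk⟩ := h
  have hp1 : (1 : ℝ) < p := by exact_mod_cast hp.one_lt
  have hp0 : (0 : ℝ) < p := by linarith
  have hε1 : (1 : ℝ) < 1 + ε := by linarith
  -- geometric growth from `k₀`: `bR ⟨p^(k₀+j)⟩ ≥ (p²(1+ε))^j`
  have hb0 : (1 : ℝ) ≤ (algBorderRank (matMulTensor ℂ (p ^ k₀) (p ^ k₀) (p ^ k₀)) : ℝ) := by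
    exact_mod_cast one_le_algBorderRank_matMulTensor (n := p ^ k₀) (Nat.one_le_pow _ _ hp.pos)
  have hgrow : ∀ j : ℕ, ((p : ℝ) ^ 2 * (1 + ε)) ^ j ≤
      (algBorderRank (matMulTensor ℂ (p ^ (k₀ + j)) (p ^ (k₀ + j)) (p ^ (k₀ + j))) : ℝ) := by
    intro j
    induction j with
    | zero => simpa using hb0
    | succ j ih =>
      have hstep := hk (k₀ + j) (Nat.le_add_right _ _)
      have hq : (0 : ℝ) ≤ (p : ℝ) ^ 2 * (1 + ε) := by positivity
      calc ((p : ℝ) ^ 2 * (1 + ε)) ^ (j + 1)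
          = (p : ℝ) ^ 2 * (1 + ε) * ((p : ℝ) ^ 2 * (1 + ε)) ^ j := by ring
        _ ≤ (p : ℝ) ^ 2 * (1 + ε) *
              (algBorderRank (matMulTensor ℂ (p ^ (k₀ + j)) (p ^ (k₀ + j)) (p ^ (k₀ + j))) : ℝ) :=
            mul_le_mul_of_nonneg_left ih hq
        _ ≤ _ := hstep
  -- the exponent: `p^δ = (1+ε)^(1/2)`
  set δ : ℝ := Real.logb p (1 + ε) / 2 with hδ
  have hδpos : 0 < δ := by
    have : 0 < Real.logb p (1 + ε) := Real.logb_pos hp1 hε1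
    rw [hδ]
    linarith
  have hpδ : (p : ℝ) ^ δ = Real.sqrt (1 + ε) := by
    rw [hδ, div_eq_mul_inv, Real.rpow_mul hp0.le, Real.rpow_logb hp0 hp1.ne' (by linarith),
      Real.sqrt_eq_rpow, one_div]
  have hs1 : 1 < Real.sqrt (1 + ε) := by
    have := Real.sqrt_lt_sqrt zero_le_one hε1
    rwa [Real.sqrt_one] at this
  -- `C := (p²(1+ε))^k₀`, the loss from starting at `k₀`; powers of `sqrt (1+ε)` eventually beat it
  set C : ℝ := ((p : ℝ) ^ 2 * (1 + ε)) ^ k₀ with hC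
  have hCpos : 0 < C := by positivity
  obtain ⟨N, hN⟩ :=
    ((tendsto_pow_atTop_atTop_of_one_lt hs1).eventually_gt_atTop C).exists_forall_of_atTop
  refine ⟨p, hp, δ, hδpos, max k₀ N, fun k hk => ?_⟩
  have hk₀ : k₀ ≤ k := le_of_max_le_left hk
  have hkN : N ≤ k := le_of_max_le_right hk
  obtain ⟨j, rfl⟩ := Nat.exists_eq_add_of_le hk₀
  -- `(p^(k₀+j))^(2+δ) = p^(2(k₀+j)) · sqrt(1+ε)^(k₀+j)`
  have h2 : ((p : ℝ) ^ (k₀ + j)) ^ δ = Real.sqrt (1 + ε) ^ (k₀ + j) := by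
    rw [← Real.rpow_natCast (p : ℝ) (k₀ + j), ← Real.rpow_mul hp0.le, mul_comm,
      Real.rpow_mul hp0.le, hpδ, Real.rpow_natCast]
  have hlhs : (((p ^ (k₀ + j) : ℕ) : ℝ)) ^ (2 + δ) =
      (p : ℝ) ^ (2 * (k₀ + j)) * Real.sqrt (1 + ε) ^ (k₀ + j) := by
    have hpk : (0 : ℝ) < (p : ℝ) ^ (k₀ + j) := by positivity
    push_cast
    rw [Real.rpow_add hpk, Real.rpow_two, ← pow_mul, mul_comm (k₀ + j) 2, h2]
  have hNj : C < Real.sqrt (1 + ε) ^ (k₀ + j) := hN (k₀ + j) hkN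
  rw [hlhs]
  refine lt_of_lt_of_le ?_ (hgrow j)
  -- `p^(2(k₀+j)) s^(k₀+j) · C < p^(2(k₀+j)) s^(k₀+j) · s^(k₀+j) = (p²(1+ε))^j · C`
  have key : (p : ℝ) ^ (2 * (k₀ + j)) * Real.sqrt (1 + ε) ^ (k₀ + j) * C <
      ((p : ℝ) ^ 2 * (1 + ε)) ^ j * C := by
    calc (p : ℝ) ^ (2 * (k₀ + j)) * Real.sqrt (1 + ε) ^ (k₀ + j) * C
        < (p : ℝ) ^ (2 * (k₀ + j)) * Real.sqrt (1 + ε) ^ (k₀ + j) * Real.sqrt (1 + ε) ^ (k₀ + j) :=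
          mul_lt_mul_of_pos_left hNj (by positivity)
      _ = ((p : ℝ) ^ 2 * (1 + ε)) ^ j * C := by
          rw [hC, mul_assoc, ← mul_pow, Real.mul_self_sqrt (by linarith : (0 : ℝ) ≤ 1 + ε)]
          generalize (1 + ε) = s
          ring
  exact lt_of_mul_lt_mul_right key hCpos.le

end Summit.MatrixMultiplication.MatrixMultiplication.Theorems

end
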